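import Literature.MathematicalPhysics.QuantumLattice.GluedGaugeTransformation
import Mathlib.Analysis.Calculus.FDeriv.Star
import Mathlib.Topology.Algebra.Module.Star
import HarnessLib

/-!
# The glued small connection near the sphere `S_r ⊂ ℝ⁴`

QuantumLattice support file (everything proved; one definition, no named facts) on the proof
path of `Literature.MathematicalPhysics.QuantumLattice.Waldron2019_yangMillsFlow_flatTorus`
(A. Waldron, Invent. math. 217 (2019)), Lemma 3.5 / §4: the connection
`B = g⋆ A g + g⋆ dg` of the glued unitary gauge `g = gluedGauge` (`GluedGaugeTransformation`)
on the shell `gluedNbhd r`, and its SMALLNESS ON THE SPHERE `‖z‖ = r`: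
`‖B(z) v‖ ≤ C_N (ε/r) ‖v‖` (`norm_gluedConn_le_sphere`), where `ε/r²` bounds the curvature on
the solid shell `r/4 ≤ ‖w‖ ≤ 2r` and `C_N` depends only on `N` (through `‖1‖` and the derivative
bound of the smooth step).

* `gluedConn`, `contDiffOn_gluedConn`;
* `gauge_mul_identity` — `(g₊k)⋆A(g₊k) + (g₊k)⋆d(g₊k) = k⋆Ã₊k + k⋆dk` (`g₊⋆g₊ = 1`);
* `gluedConn_eq_cayley_region`, `gluedConn_eq_south_region` — the two local forms;
* `norm_fderiv_gluedK_le` — `‖dk‖ ≲ ε/r` on the band;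
* `norm_gluedConn_le_sphere`.

References: A. Waldron, Invent. math. 217 (2019), Lemma 3.5 / §4 [Waldron2019]; K. Uhlenbeck,
Comm. Math. Phys. 83 (1982) [folklore].
-/

noncomputable section

open scoped RealInnerProductSpace Matrix.Norms.Frobenius ContDiff Topology
open Set Metric Filter
open Literature.Analysis.InnerProduct Literature.Analysis.OperatorTheory

namespace Literature.MathematicalPhysics.QuantumLattice

/-! ### Applied forms of generic operator-norm bounds (no operator norms on matrix-valued maps) -/

section GenericApplied

universe u

variable {E : Type u} [NormedAddCommGroup E] [InnerProductSpace ℝ E] [CompleteSpace E]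
variable {𝔸 : Type u} [NormedRing 𝔸] [NormedAlgebra ℝ 𝔸] [CompleteSpace 𝔸]

/-- Applied form of `norm_fderiv_gaugeTransition_le`. [folklore] -/
theorem norm_fderiv_gaugeTransition_apply_le {A : Connection E 𝔸} (hA : ContDiff ℝ 1 A) (c₁ c₂ : E)
    {w : E} {m K : ℝ} (hm : 0 ≤ m) (hK : 0 ≤ K)
    (h1 : ∀ v, ‖expConn hA c₁ w v‖ ≤ m * ‖v‖) (h2 : ∀ v, ‖expConn hA c₂ w v‖ ≤ m * ‖v‖)
    (hh : ‖gaugeTransition hA c₁ c₂ w‖ ≤ K) (v : E) :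
    ‖fderiv ℝ (gaugeTransition hA c₁ c₂) w v‖ ≤ 2 * m * K * ‖v‖ :=
  (ContinuousLinearMap.le_opNorm _ _).trans
    (mul_le_mul_of_nonneg_right (norm_fderiv_gaugeTransition_le hA c₁ c₂ hm hK h1 h2 hh) (norm_nonneg _))

/-- Applied form of `norm_fderiv_cayleyU_le`. [folklore] -/
theorem norm_fderiv_cayleyU_apply_le {T : 𝔸} (hT : ‖T‖ ≤ 1 / 2) (H : 𝔸) :
    ‖fderiv ℝ (cayleyU (R := 𝔸)) T H‖ ≤
      ((‖(1 : 𝔸)‖ + 1) + (‖(1 : 𝔸)‖ + 1 / 2) * (‖(1 : 𝔸)‖ + 1) ^ 2) * ‖H‖ :=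
  (ContinuousLinearMap.le_opNorm _ _).trans
    (mul_le_mul_of_nonneg_right (norm_fderiv_cayleyU_le hT) (norm_nonneg _))

/-- Applied form of `norm_fderiv_cayleyUInv_le`. [folklore] -/
theorem norm_fderiv_cayleyUInv_apply_le {W : 𝔸} (hW : ‖W - 1‖ ≤ 1) (H : 𝔸) :
    ‖fderiv ℝ (cayleyUInv (R := 𝔸)) W H‖ ≤
      ((1 / 2) * (‖(1 : 𝔸)‖ + 1) + ((1 / 2) * (‖(1 : 𝔸)‖ + 1)) ^ 2) * ‖H‖ :=
  (ContinuousLinearMap.le_opNorm _ _).trans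
    (mul_le_mul_of_nonneg_right (norm_fderiv_cayleyUInv_le hW) (norm_nonneg _))

omit [CompleteSpace E] [CompleteSpace 𝔸] in
/-- **Smoothness of a conjugated connection** `z ↦ sg(z) A(z) g(z) + sg(z) dg(z)` on an open set
(generic coefficients, finite-dimensional base; `sg` plays the role of `g⋆`). [folklore] -/
theorem contDiffOn_conjConnection [FiniteDimensional ℝ E] {n : ℕ∞} {g sg : E → 𝔸} {U : Set E}
    (hU : IsOpen U) (hg : ContDiffOn ℝ (n + 1) g U) (hsg : ContDiffOn ℝ n sg U) {A : Connection E 𝔸}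
    (hA : ContDiffOn ℝ n A U) :
    ContDiffOn ℝ n (fun z => (ContinuousLinearMap.mulLeftRight ℝ 𝔸 (sg z) (g z)).comp (A z) +
      (ContinuousLinearMap.mul ℝ 𝔸 (sg z)).comp (fderiv ℝ g z)) U := by
  have hg' : ContDiffOn ℝ n g U := hg.of_le (by exact_mod_cast le_self_add)
  have hDg : ContDiffOn ℝ n (fderiv ℝ g) U := hg.fderiv_of_isOpen hU le_rfl
  refine contDiffOn_clm_apply.2 fun v => ?_
  have hAv : ContDiffOn ℝ n (fun z => A z v) U := hA.clm_apply contDiffOn_const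
  have hDgv : ContDiffOn ℝ n (fun z => fderiv ℝ g z v) U := hDg.clm_apply contDiffOn_const
  have h : ContDiffOn ℝ n (fun z => sg z * A z v * g z + sg z * fderiv ℝ g z v) U :=
    ((hsg.mul hAv).mul hg').add (hsg.mul hDgv)
  refine h.congr fun z _ => ?_
  simp only [add_apply, ContinuousLinearMap.comp_apply, ContinuousLinearMap.mulLeftRight_apply,
    ContinuousLinearMap.mul_apply']

end GenericApplied

variable {N : ℕ}

local notation "𝔼" => EuclideanSpace ℝ (Fin 4)
local notation "𝕓" => EuclideanSpace.basisFun (Fin 4) ℝ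
local notation "𝔤" => Matrix (Fin N) (Fin N) ℂ

/-! ### The glued connection -/

/-- **The glued connection** `B(z)(v) = g(z)⋆ A(z)(v) g(z) + g(z)⋆ dg(z)(v)`. [folklore] -/
def gluedConn {A : Connection 𝔼 𝔤} (hA : ContDiff ℝ 1 A) (r : ℝ) : Connection 𝔼 𝔤 := fun z =>
  (ContinuousLinearMap.mulLeftRight ℝ 𝔤 (star (gluedGauge hA r z)) (gluedGauge hA r z)).comp (A z) +
    (ContinuousLinearMap.mul ℝ 𝔤 (star (gluedGauge hA r z))).comp (fderiv ℝ (gluedGauge hA r) z)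

/-- Unfolding lemma. [folklore] -/
theorem gluedConn_apply {A : Connection 𝔼 𝔤} (hA : ContDiff ℝ 1 A) (r : ℝ) (z v : 𝔼) :
    gluedConn hA r z v = star (gluedGauge hA r z) * A z v * gluedGauge hA r z +
      star (gluedGauge hA r z) * fderiv ℝ (gluedGauge hA r) z v := by
  simp only [gluedConn, add_apply, ContinuousLinearMap.comp_apply, ContinuousLinearMap.mulLeftRight_apply,
    ContinuousLinearMap.mul_apply']
  rfl

/-- **Gauge transforming by a product**: for `g₊` with `g₊⋆g₊ = 1` and `k`, both differentiable
at `z`, `(g₊k)⋆ X (g₊k) + (g₊k)⋆ d(g₊k)(v) = k⋆ (g₊⋆ X g₊ + g₊⋆ dg₊(v)) k + k⋆ dk(v)`. [folklore] -/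
theorem gauge_mul_identity {gp k : 𝔼 → 𝔤} {z : 𝔼} (hgp : DifferentiableAt ℝ gp z)
    (hk : DifferentiableAt ℝ k z) (hu : star (gp z) * gp z = 1) (X : 𝔤) (v : 𝔼) :
    star (gp z * k z) * X * (gp z * k z) + star (gp z * k z) * fderiv ℝ (fun y => gp y * k y) z v =
      star (k z) * (star (gp z) * X * gp z + star (gp z) * fderiv ℝ gp z v) * k z +
        star (k z) * fderiv ℝ k z v := by
  have h := hgp.hasFDerivAt.mul' hk.hasFDerivAt
  have h2 : HasFDerivAt (fun y => gp y * k y)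
      (gp z • fderiv ℝ k z + MulOpposite.op (k z) • fderiv ℝ gp z) z := h
  rw [h2.fderiv]
  simp only [FunLike.coe_add, Pi.add_apply, smul_apply, smul_eq_mul, MulOpposite.smul_eq_mul_unop,
    MulOpposite.unop_op, star_mul]
  have key : star (k z) * star (gp z) * (gp z * (fderiv ℝ k z) v) =
      star (k z) * (star (gp z) * gp z) * (fderiv ℝ k z) v := by noncomm_ring
  rw [mul_add, key, hu]
  noncomm_ring

/-! ### Derivative of `k` on the band -/

section BandDeriv

/-- The goodness predicate on a neighbourhood: `‖W − 1‖ ≤ 1/2` and `‖S‖ ≤ 1/2`. [folklore] -/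
theorem good_nhds [NeZero N] {A : Connection 𝔼 𝔤} (hA1 : ContDiff ℝ 1 A) (hA2 : ContDiff ℝ 2 A)
    (hskew : IsSkewValued A) {r ε : ℝ} (hr : 0 < r) (hε0 : 0 ≤ ε) (hε1 : ε ≤ epsOne N)
    (hF : ShellCurvatureBound A r ε) {z : 𝔼} (h1 : 3 / 4 * r < ‖z‖) (h2 : ‖z‖ < 13 / 10 * r)
    (h3 : -(3 / 10) * r < ⟪z, 𝕓 0⟫) (h4 : ⟪z, 𝕓 0⟫ < 3 / 10 * r) :
    ∀ᶠ y in 𝓝 z, ‖gluedW hA1 r y - 1‖ ≤ 1 / 2 ∧ ‖gluedS hA1 r y‖ ≤ 1 / 2 := by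
  have hO : IsOpen {y : 𝔼 | 3 / 4 * r < ‖y‖ ∧ ‖y‖ < 13 / 10 * r ∧ -(3 / 10) * r < ⟪y, 𝕓 0⟫ ∧
      ⟪y, 𝕓 0⟫ < 3 / 10 * r} :=
    (isOpen_lt continuous_const continuous_norm).and
      ((isOpen_lt continuous_norm continuous_const).and
        ((isOpen_lt continuous_const (continuous_id.inner continuous_const)).and
          (isOpen_lt (continuous_id.inner continuous_const) continuous_const)))
  filter_upwards [hO.mem_nhds ⟨h1, h2, h3, h4⟩] with y hy
  exact glued_good hA1 hA2 hskew hr hε0 hε1 hF (inBand_of hr hy.1.le hy.2.1.le hy.2.2.1.le hy.2.2.2.le)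

/-- **Derivative bound for the transition map on the band**: `‖dh(z)v‖ ≤ (12/5)‖1‖(ε/r)‖v‖`.
[folklore] -/
theorem norm_fderiv_gaugeTransition_band_le {A : Connection 𝔼 𝔤} (hA1 : ContDiff ℝ 1 A)
    (hA2 : ContDiff ℝ 2 A) (hskew : IsSkewValued A) {r ε : ℝ} (hr : 0 < r) (hε0 : 0 ≤ ε)
    (hF : ShellCurvatureBound A r ε) {z : 𝔼} (hz : InBand r (poleP r) z) (v : 𝔼) :
    ‖fderiv ℝ (gaugeTransition hA1 (poleP r) (-poleP r)) z v‖ ≤ 12 / 5 * ‖(1 : 𝔤)‖ * (ε / r) * ‖v‖ := by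
  have hc : ‖poleP r‖ = r := by
    rw [poleP, norm_smul, Real.norm_eq_abs, abs_of_pos hr, (EuclideanSpace.basisFun (Fin 4) ℝ).orthonormal.1 0, mul_one]
  have hc' : ‖-poleP r‖ = r := by rw [norm_neg, hc]
  obtain ⟨hz1, hz2, hz3, hz4⟩ := hz
  have hz1' : r / 2 ≤ ‖z‖ := by linarith
  have hz2' : ‖z‖ ≤ 7 / 5 * r := by linarith
  have hm : 0 ≤ 6 / 5 * (ε / r) := by positivity
  have h := norm_fderiv_gaugeTransition_apply_le hA1 (poleP r) (-poleP r) hm (norm_nonneg (1 : 𝔤))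
    (fun w => norm_expConn_pole_le hA2 hskew hr hε0 hF hc hz1' hz2' hz3 w)
    (fun w => norm_expConn_pole_le hA2 hskew hr hε0 hF hc' hz1' hz2' (by rw [inner_neg_left]; linarith) w)
    (norm_gaugeTransition_eq hA1 hskew _ _ z).le v
  calc ‖fderiv ℝ (gaugeTransition hA1 (poleP r) (-poleP r)) z v‖
      ≤ 2 * (6 / 5 * (ε / r)) * ‖(1 : 𝔤)‖ * ‖v‖ := h
    _ = 12 / 5 * ‖(1 : 𝔤)‖ * (ε / r) * ‖v‖ := by ring

/-- The constant in the derivative bound for `k`. [folklore] -/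
def kDerivConst (N : ℕ) (Cχ : ℝ) : ℝ :=
  ((‖(1 : Matrix (Fin N) (Fin N) ℂ)‖ + 1) + (‖(1 : Matrix (Fin N) (Fin N) ℂ)‖ + 1 / 2) *
      (‖(1 : Matrix (Fin N) (Fin N) ℂ)‖ + 1) ^ 2) *
    (Cχ * ((1 / 2) * (‖(1 : Matrix (Fin N) (Fin N) ℂ)‖ + 1) * (16 * ‖(1 : Matrix (Fin N) (Fin N) ℂ)‖)) +
      ((1 / 2) * (‖(1 : Matrix (Fin N) (Fin N) ℂ)‖ + 1) + ((1 / 2) * (‖(1 : Matrix (Fin N) (Fin N) ℂ)‖ + 1)) ^ 2) *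
        (12 / 5 * ‖(1 : Matrix (Fin N) (Fin N) ℂ)‖))

/-- Auxiliary lemma (see the module docstring). [folklore] -/
theorem kDerivConst_nonneg (N : ℕ) {Cχ : ℝ} (hC : 0 ≤ Cχ) : 0 ≤ kDerivConst N Cχ := by
  unfold kDerivConst; positivity

/-- **`‖dk(z) v‖ ≤ kDerivConst · (ε/r) ‖v‖` at band points** (`3r/4 < ‖z‖ < 13r/10`,
`|z₀| < (3/10) r`), where `Cχ` bounds `|χ'|`. [folklore] -/
theorem norm_fderiv_gluedK_band_le [NeZero N] {A : Connection 𝔼 𝔤} (hA1 : ContDiff ℝ 1 A)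
    (hA2 : ContDiff ℝ 2 A) (hskew : IsSkewValued A) {r ε : ℝ} (hr : 0 < r) (hε0 : 0 ≤ ε)
    (hε1 : ε ≤ epsOne N) (hF : ShellCurvatureBound A r ε) {Cχ : ℝ} (hCχ0 : 0 ≤ Cχ)
    (hCχ : ∀ t, ‖deriv gluedStep t‖ ≤ Cχ) {z : 𝔼} (h1 : 3 / 4 * r < ‖z‖) (h2 : ‖z‖ < 13 / 10 * r)
    (h3 : -(3 / 10) * r < ⟪z, 𝕓 0⟫) (h4 : ⟪z, 𝕓 0⟫ < 3 / 10 * r) (v : 𝔼) :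
    ‖fderiv ℝ (gluedK hA1 r) z v‖ ≤ kDerivConst N Cχ * (ε / r) * ‖v‖ := by
  set K1 := ‖(1 : 𝔤)‖ with hK1
  have hband : InBand r (poleP r) z := inBand_of hr h1.le h2.le h3.le h4.le
  have hgz := glued_good hA1 hA2 hskew hr hε0 hε1 hF hband
  have hWlt : ‖gluedW hA1 r z - 1‖ < 2 := by linarith [hgz.1]
  have hSlt : ‖gluedS hA1 r z‖ < 1 := by linarith [hgz.2]
  -- `k = cayleyU ∘ T` near `z`
  have hev : gluedK hA1 r =ᶠ[𝓝 z] fun y => cayleyU (gluedT hA1 r y) := by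
    filter_upwards [good_nhds hA1 hA2 hskew hr hε0 hε1 hF h1 h2 h3 h4] with y hy
    exact gluedK_eq_cayleyU_of hA1 hr fun _ => ⟨by linarith [hy.1], by linarith [hy.2]⟩
  -- derivatives of the pieces
  set h := gaugeTransition hA1 (poleP r) (-poleP r) with hh_def
  set u : 𝔤 := star (h (baseP r)) with hu_def
  have hu_unit : u ∈ unitary 𝔤 := Unitary.star_mem (gaugeTransition_mem_unitary hA1 hskew _ _ _)
  have hhd : Differentiable ℝ h := (contDiff_gaugeTransition le_rfl hA1 _ _).differentiable (by simp)
  have hW : HasFDerivAt (gluedW hA1 r) (MulOpposite.op u • fderiv ℝ h z) z := by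
    have := (hhd z).hasFDerivAt.mul_const' u
    exact this
  have hS : HasFDerivAt (gluedS hA1 r) ((fderiv ℝ cayleyUInv (gluedW hA1 r z)).comp
      (MulOpposite.op u • fderiv ℝ h z)) z := by
    have hci : DifferentiableAt ℝ (cayleyUInv (R := 𝔤)) (gluedW hA1 r z) :=
      (contDiffAt_cayleyUInv (n := 1) hWlt).differentiableAt one_ne_zero
    exact hci.hasFDerivAt.comp z hW
  have hχd : HasFDerivAt (fun y : 𝔼 => gluedStep (⟪y, 𝕓 0⟫ / r))
      ((deriv gluedStep (⟪z, 𝕓 0⟫ / r)) • ((1 / r) • (innerSL ℝ (𝕓 0 : 𝔼) : 𝔼 →L[ℝ] ℝ))) z := by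
    have hlin : HasFDerivAt (fun y : 𝔼 => ⟪y, 𝕓 0⟫ / r) ((1 / r) • (innerSL ℝ (𝕓 0 : 𝔼) : 𝔼 →L[ℝ] ℝ)) z := by
      have h0 : HasFDerivAt (fun y : 𝔼 => ⟪y, 𝕓 0⟫) (innerSL ℝ (𝕓 0 : 𝔼) : 𝔼 →L[ℝ] ℝ) z := by
        have := (innerSL ℝ (𝕓 0 : 𝔼) : 𝔼 →L[ℝ] ℝ).hasFDerivAt (x := z)
        simpa [innerSL_apply_apply, real_inner_comm] using this
      have := h0.const_mul (1 / r)
      simpa [div_eq_inv_mul, one_div] using this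
    have hg : HasDerivAt gluedStep (deriv gluedStep (⟪z, 𝕓 0⟫ / r)) (⟪z, 𝕓 0⟫ / r) :=
      ((contDiff_gluedStep (n := 1)).differentiable (by simp) _).hasDerivAt
    have hcomp := hg.hasFDerivAt.comp z hlin
    refine hcomp.congr_fderiv ?_
    ext w
    simp only [ContinuousLinearMap.comp_apply, smul_apply, innerSL_apply_apply, smul_eq_mul,
      ContinuousLinearMap.toSpanSingleton_apply]
    ring
  have hT : HasFDerivAt (gluedT hA1 r)
      ((gluedStep (⟪z, 𝕓 0⟫ / r)) • ((fderiv ℝ cayleyUInv (gluedW hA1 r z)).comp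
          (MulOpposite.op u • fderiv ℝ h z)) +
        ((deriv gluedStep (⟪z, 𝕓 0⟫ / r)) • ((1 / r) • (innerSL ℝ (𝕓 0 : 𝔼) : 𝔼 →L[ℝ] ℝ))).smulRight
          (gluedS hA1 r z)) z := hχd.smul hS
  have hTlt : ‖gluedT hA1 r z‖ < 1 := (norm_gluedT_le hA1 r z).trans_lt hSlt
  have hcay : DifferentiableAt ℝ (cayleyU (R := 𝔤)) (gluedT hA1 r z) :=
    (contDiffAt_cayleyU (n := 1) hTlt).differentiableAt one_ne_zero
  have hk : HasFDerivAt (gluedK hA1 r) ((fderiv ℝ cayleyU (gluedT hA1 r z)).comp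
      ((gluedStep (⟪z, 𝕓 0⟫ / r)) • ((fderiv ℝ cayleyUInv (gluedW hA1 r z)).comp
          (MulOpposite.op u • fderiv ℝ h z)) +
        ((deriv gluedStep (⟪z, 𝕓 0⟫ / r)) • ((1 / r) • (innerSL ℝ (𝕓 0 : 𝔼) : 𝔼 →L[ℝ] ℝ))).smulRight
          (gluedS hA1 r z))) z :=
    (hcay.hasFDerivAt.comp z hT).congr_of_eventuallyEq hev
  rw [hk.fderiv]
  -- ### norm bounds
  have hTle : ‖gluedT hA1 r z‖ ≤ 1 / 2 := (norm_gluedT_le hA1 r z).trans hgz.2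
  have hC2 := fun H => norm_fderiv_cayleyUInv_apply_le (W := gluedW hA1 r z) (by linarith [hgz.1]) H
  have hdh := norm_fderiv_gaugeTransition_band_le hA1 hA2 hskew hr hε0 hF hband v
  have hχle : ‖deriv gluedStep (⟪z, 𝕓 0⟫ / r)‖ ≤ Cχ := hCχ _
  have hSle : ‖gluedS hA1 r z‖ ≤ (1 / 2) * (K1 + 1) * (16 * K1 * ε) := by
    have hW16 : ‖gluedW hA1 r z - 1‖ ≤ 16 * K1 * ε :=
      norm_gaugeTransition_mul_star_base_sub_one_le hA2 hskew hr hε0 hF hband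
    exact (norm_cayleyUInv_le (by linarith [hgz.1])).trans (mul_le_mul_of_nonneg_left hW16 (by positivity))
  have hχ01 : 0 ≤ gluedStep (⟪z, 𝕓 0⟫ / r) ∧ gluedStep (⟪z, 𝕓 0⟫ / r) ≤ 1 :=
    ⟨gluedStep_nonneg _, gluedStep_le_one _⟩
  -- the inner vector
  set inner_vec := ((gluedStep (⟪z, 𝕓 0⟫ / r)) • ((fderiv ℝ cayleyUInv (gluedW hA1 r z)).comp
      (MulOpposite.op u • fderiv ℝ h z)) +
    ((deriv gluedStep (⟪z, 𝕓 0⟫ / r)) • ((1 / r) • (innerSL ℝ (𝕓 0 : 𝔼) : 𝔼 →L[ℝ] ℝ))).smulRight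
      (gluedS hA1 r z)) v with hiv
  have hiv_le : ‖inner_vec‖ ≤ (Cχ * ((1 / 2) * (K1 + 1) * (16 * K1)) +
      ((1 / 2) * (K1 + 1) + ((1 / 2) * (K1 + 1)) ^ 2) * (12 / 5 * K1)) * (ε / r) * ‖v‖ := by
    rw [hiv]
    simp only [add_apply, smul_apply, ContinuousLinearMap.comp_apply, ContinuousLinearMap.smulRight_apply,
      innerSL_apply_apply, MulOpposite.smul_eq_mul_unop, MulOpposite.unop_op]
    have hv0 := norm_nonneg v
    -- first term: `χ • DcInv(W)[dh v * u]`
    have t1 : ‖gluedStep (⟪z, 𝕓 0⟫ / r) • fderiv ℝ cayleyUInv (gluedW hA1 r z) (fderiv ℝ h z v * u)‖ ≤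
        ((1 / 2) * (K1 + 1) + ((1 / 2) * (K1 + 1)) ^ 2) * (12 / 5 * K1 * (ε / r) * ‖v‖) := by
      rw [norm_smul, Real.norm_eq_abs, abs_of_nonneg hχ01.1]
      calc gluedStep (⟪z, 𝕓 0⟫ / r) * ‖fderiv ℝ cayleyUInv (gluedW hA1 r z) (fderiv ℝ h z v * u)‖
          ≤ 1 * ‖fderiv ℝ cayleyUInv (gluedW hA1 r z) (fderiv ℝ h z v * u)‖ :=
            mul_le_mul_of_nonneg_right hχ01.2 (norm_nonneg _)
        _ ≤ ((1 / 2) * (K1 + 1) + ((1 / 2) * (K1 + 1)) ^ 2) * ‖fderiv ℝ h z v * u‖ := by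
            rw [one_mul]; exact hC2 _
        _ = ((1 / 2) * (K1 + 1) + ((1 / 2) * (K1 + 1)) ^ 2) * ‖fderiv ℝ h z v‖ := by rw [norm_mul_unitary hu_unit]
        _ ≤ ((1 / 2) * (K1 + 1) + ((1 / 2) * (K1 + 1)) ^ 2) * (12 / 5 * K1 * (ε / r) * ‖v‖) :=
            mul_le_mul_of_nonneg_left hdh (by positivity)
    -- second term: `(χ'(z₀/r) ⟨z? no: ⟨𝕓0, v⟩/r) • S`
    have t2 : ‖(deriv gluedStep (⟪z, 𝕓 0⟫ / r) * ((1 / r) * ⟪(𝕓 : OrthonormalBasis (Fin 4) ℝ 𝔼) 0, v⟫)) •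
        gluedS hA1 r z‖ ≤ Cχ * ((1 / 2) * (K1 + 1) * (16 * K1)) * (ε / r) * ‖v‖ := by
      rw [norm_smul, Real.norm_eq_abs, abs_mul, abs_mul, abs_of_pos (by positivity : (0 : ℝ) < 1 / r)]
      have hin : |⟪(𝕓 : OrthonormalBasis (Fin 4) ℝ 𝔼) 0, v⟫| ≤ ‖v‖ := by
        have := abs_real_inner_le_norm ((𝕓 : OrthonormalBasis (Fin 4) ℝ 𝔼) 0) v
        rwa [(EuclideanSpace.basisFun (Fin 4) ℝ).orthonormal.1 0, one_mul] at this
      have hχabs : |deriv gluedStep (⟪z, 𝕓 0⟫ / r)| ≤ Cχ := by rwa [Real.norm_eq_abs] at hχle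
      calc |deriv gluedStep (⟪z, 𝕓 0⟫ / r)| * (1 / r * |⟪(𝕓 : OrthonormalBasis (Fin 4) ℝ 𝔼) 0, v⟫|) *
            ‖gluedS hA1 r z‖
          ≤ Cχ * (1 / r * ‖v‖) * ((1 / 2) * (K1 + 1) * (16 * K1 * ε)) := by
            refine mul_le_mul (mul_le_mul hχabs (mul_le_mul_of_nonneg_left hin (by positivity))
              (by positivity) hCχ0) hSle (norm_nonneg _) (by positivity)
        _ = Cχ * ((1 / 2) * (K1 + 1) * (16 * K1)) * (ε / r) * ‖v‖ := by ring
    calc _ ≤ ‖gluedStep (⟪z, 𝕓 0⟫ / r) • fderiv ℝ cayleyUInv (gluedW hA1 r z) (fderiv ℝ h z v * u)‖ +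
          ‖(deriv gluedStep (⟪z, 𝕓 0⟫ / r) * ((1 / r) * ⟪(𝕓 : OrthonormalBasis (Fin 4) ℝ 𝔼) 0, v⟫)) •
            gluedS hA1 r z‖ := norm_add_le _ _
      _ ≤ _ := by nlinarith [t1, t2]
  calc ‖fderiv ℝ cayleyU (gluedT hA1 r z) inner_vec‖
      ≤ ((K1 + 1) + (K1 + 1 / 2) * (K1 + 1) ^ 2) * ‖inner_vec‖ := norm_fderiv_cayleyU_apply_le hTle _
    _ ≤ ((K1 + 1) + (K1 + 1 / 2) * (K1 + 1) ^ 2) *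
          ((Cχ * ((1 / 2) * (K1 + 1) * (16 * K1)) +
            ((1 / 2) * (K1 + 1) + ((1 / 2) * (K1 + 1)) ^ 2) * (12 / 5 * K1)) * (ε / r) * ‖v‖) :=
        mul_le_mul_of_nonneg_left hiv_le (by positivity)
    _ = kDerivConst N Cχ * (ε / r) * ‖v‖ := by rw [kDerivConst]; ring

end BandDeriv

/-! ### Smoothness of the glued connection on the shell -/

section SmoothConn

/-- **The glued connection is `C^n` on the shell** when `A ∈ C^{n+1}` (`ε ≤ ε₁`). [folklore] -/
theorem contDiffOn_gluedConn [NeZero N] {n : ℕ∞} {A : Connection 𝔼 𝔤} (hA1 : ContDiff ℝ 1 A)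
    (hA2 : ContDiff ℝ 2 A) (hA : ContDiff ℝ (n + 1) A) (hskew : IsSkewValued A) {r ε : ℝ}
    (hr : 0 < r) (hε0 : 0 ≤ ε) (hε1 : ε ≤ epsOne N) (hF : ShellCurvatureBound A r ε) :
    ContDiffOn ℝ n (gluedConn hA1 r) (gluedNbhd r) := by
  have hg : ContDiffOn ℝ (n + 1) (gluedGauge hA1 r) (gluedNbhd r) :=
    contDiffOn_gluedGauge (n := n + 1) (by exact_mod_cast le_add_self) hA1 hA2 hA hskew hr hε0 hε1 hF
  have hsg : ContDiffOn ℝ n (fun z => star (gluedGauge hA1 r z)) (gluedNbhd r) :=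
    ((starL' ℝ : 𝔤 ≃L[ℝ] 𝔤).contDiff.comp_contDiffOn hg).of_le (by exact_mod_cast le_self_add)
  have hAn : ContDiffOn ℝ n A (gluedNbhd r) := (hA.of_le (by exact_mod_cast le_self_add)).contDiffOn
  exact contDiffOn_conjConnection (isOpen_gluedNbhd r) hg hsg hAn

end SmoothConn

/-! ### Smallness of the glued connection on the sphere -/

section Sphere

/-- Norm of the pole: `‖poleP r‖ = r`. [folklore] -/
theorem norm_poleP {r : ℝ} (hr : 0 < r) : ‖poleP r‖ = r := by
  rw [poleP, norm_smul, Real.norm_eq_abs, abs_of_pos hr, (EuclideanSpace.basisFun (Fin 4) ℝ).orthonormal.1 0,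
    mul_one]

/-- **The glued gauge in the southern region is `g₋ · h(p)⋆`** (near every shell point with
`z₀ < −r/8`). [folklore] -/
theorem gluedGauge_eventuallyEq_south [NeZero N] {A : Connection 𝔼 𝔤} (hA1 : ContDiff ℝ 1 A)
    (hA2 : ContDiff ℝ 2 A) (hskew : IsSkewValued A) {r ε : ℝ} (hr : 0 < r) (hε0 : 0 ≤ ε)
    (hε1 : ε ≤ epsOne N) (hF : ShellCurvatureBound A r ε) {z : 𝔼} (hz : z ∈ gluedNbhd r)
    (hz0 : ⟪z, 𝕓 0⟫ < -(r / 8)) :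
    gluedGauge hA1 r =ᶠ[𝓝 z] fun y => expGauge (-poleP r) A y *
      star (gaugeTransition hA1 (poleP r) (-poleP r) (baseP r)) := by
  obtain ⟨hz1, hz2⟩ := hz
  have hO : IsOpen {y : 𝔼 | 3 / 4 * r < ‖y‖ ∧ ‖y‖ < 13 / 10 * r ∧ ⟪y, 𝕓 0⟫ < -(r / 8)} :=
    (isOpen_lt continuous_const continuous_norm).and
      ((isOpen_lt continuous_norm continuous_const).and
        (isOpen_lt (continuous_id.inner continuous_const) continuous_const))
  have hzO : z ∈ {y : 𝔼 | 3 / 4 * r < ‖y‖ ∧ ‖y‖ < 13 / 10 * r ∧ ⟪y, 𝕓 0⟫ < -(r / 8)} :=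
    ⟨by linarith, by linarith, hz0⟩
  filter_upwards [hO.mem_nhds hzO] with y hy
  have hgood : -(r / 5) < ⟪y, 𝕓 0⟫ → ‖gluedW hA1 r y - 1‖ < 2 ∧ ‖gluedS hA1 r y‖ < 1 := fun h5 => by
    have hg := glued_good hA1 hA2 hskew hr hε0 hε1 hF
      (inBand_of hr hy.1.le hy.2.1.le (by linarith) (by linarith [hy.2.2]))
    exact ⟨by linarith [hg.1], by linarith [hg.2]⟩
  rw [gluedGauge, gluedK_eq_W_of hA1 hr hy.2.2.le hgood, gluedW, gaugeTransition,
    val_expGaugeUnit_inv_eq_star hA1 hskew, ← mul_assoc, ← mul_assoc,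
    (Unitary.mem_iff.1 (expGauge_mem_unitary' hA1 hskew _ _)).2, one_mul]

/-- **The glued connection is small on the sphere**: for `‖z‖ = r`,
`‖B(z)v‖ ≤ (6/5 + kDerivConst) (ε/r) ‖v‖` (`ε ≤ ε₁`, `Cχ` a bound for `|χ'|`). [folklore] -/
theorem norm_gluedConn_le_sphere [NeZero N] {A : Connection 𝔼 𝔤} (hA1 : ContDiff ℝ 1 A)
    (hA2 : ContDiff ℝ 2 A) (hskew : IsSkewValued A) {r ε : ℝ} (hr : 0 < r) (hε0 : 0 ≤ ε)
    (hε1 : ε ≤ epsOne N) (hF : ShellCurvatureBound A r ε) {Cχ : ℝ} (hCχ0 : 0 ≤ Cχ)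
    (hCχ : ∀ t, ‖deriv gluedStep t‖ ≤ Cχ) {z : 𝔼} (hz : ‖z‖ = r) (v : 𝔼) :
    ‖gluedConn hA1 r z v‖ ≤ (6 / 5 + kDerivConst N Cχ) * (ε / r) * ‖v‖ := by
  have hzN : z ∈ gluedNbhd r := ⟨by rw [hz]; linarith, by rw [hz]; linarith⟩
  have hc : ‖poleP r‖ = r := norm_poleP hr
  have hc' : ‖-poleP r‖ = r := by rw [norm_neg, hc]
  have hz1 : r / 2 ≤ ‖z‖ := by rw [hz]; linarith
  have hz2 : ‖z‖ ≤ 7 / 5 * r := by rw [hz]; linarith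
  have hKd := kDerivConst_nonneg N hCχ0
  have hgp := expGauge_mem_unitary' hA1 hskew (poleP r) z
  have hgpd : DifferentiableAt ℝ (expGauge (poleP r) A) z :=
    ((contDiff_expGauge le_rfl hA1 _).differentiable (by simp)) z
  -- bound for `|z₀|`
  have hz0abs : |⟪z, (𝕓 : OrthonormalBasis (Fin 4) ℝ 𝔼) 0⟫| ≤ r := by
    have := abs_real_inner_le_norm z ((𝕓 : OrthonormalBasis (Fin 4) ℝ 𝔼) 0)
    rwa [(EuclideanSpace.basisFun (Fin 4) ℝ).orthonormal.1 0, mul_one, hz] at this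
  by_cases hsouth : ⟪z, 𝕓 0⟫ < -(r / 8)
  · -- ### southern region: `B = u⋆ Ã₋ u`
    have hev := gluedGauge_eventuallyEq_south hA1 hA2 hskew hr hε0 hε1 hF hzN hsouth
    set u : 𝔤 := star (gaugeTransition hA1 (poleP r) (-poleP r) (baseP r)) with hu_def
    have hu_unit : u ∈ unitary 𝔤 := Unitary.star_mem (gaugeTransition_mem_unitary hA1 hskew _ _ _)
    have hgm := expGauge_mem_unitary' hA1 hskew (-poleP r) z
    have hgmd : DifferentiableAt ℝ (expGauge (-poleP r) A) z :=
      ((contDiff_expGauge le_rfl hA1 _).differentiable (by simp)) z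
    have hval : gluedGauge hA1 r z = expGauge (-poleP r) A z * u := hev.self_of_nhds
    have hder : fderiv ℝ (gluedGauge hA1 r) z v = fderiv ℝ (expGauge (-poleP r) A) z v * u := by
      rw [hev.fderiv_eq]
      have hm : HasFDerivAt (fun y => expGauge (-poleP r) A y * u)
          (MulOpposite.op u • fderiv ℝ (expGauge (-poleP r) A) z) z := hgmd.hasFDerivAt.mul_const' u
      rw [hm.fderiv]
      simp [MulOpposite.smul_eq_mul_unop]
    have hB : gluedConn hA1 r z v = star u * expConn hA1 (-poleP r) z v * u := by
      rw [gluedConn_apply, hval, hder, expConn_apply, val_expGaugeUnit_inv_eq_star hA1 hskew, star_mul]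
      noncomm_ring
    rw [hB, norm_mul_unitary hu_unit, norm_unitary_mul (Unitary.star_mem hu_unit)]
    have hsm := norm_expConn_pole_le hA2 hskew hr hε0 hF hc' hz1 hz2
      (by rw [inner_neg_left, inner_poleP]; nlinarith [abs_le.1 hz0abs]) v
    calc ‖expConn hA1 (-poleP r) z v‖ ≤ 6 / 5 * (ε / r) * ‖v‖ := hsm
      _ ≤ (6 / 5 + kDerivConst N Cχ) * (ε / r) * ‖v‖ := by
          have : 0 ≤ ε / r * ‖v‖ := by positivity
          nlinarith
  · -- ### northern/band region: `B = k⋆ Ã₊ k + k⋆ dk`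
    have hz0 : -(r / 8) ≤ ⟪z, 𝕓 0⟫ := not_lt.1 hsouth
    have hkd : DifferentiableAt ℝ (gluedK hA1 r) z :=
      ((contDiffOn_gluedK le_rfl hA1 hA2 hA1 hskew hr hε0 hε1 hF).differentiableOn (by simp) z hzN).differentiableAt
        ((isOpen_gluedNbhd r).mem_nhds hzN)
    have hku := gluedK_mem_unitary hA1 hA2 hskew hr hε0 hε1 hF hzN
    have hid := gauge_mul_identity hgpd hkd (Unitary.mem_iff.1 hgp).1 (A z v) v
    have hB : gluedConn hA1 r z v = star (gluedK hA1 r z) * expConn hA1 (poleP r) z v * gluedK hA1 r z +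
        star (gluedK hA1 r z) * fderiv ℝ (gluedK hA1 r) z v := by
      rw [gluedConn_apply, gluedGauge, show (gluedGauge hA1 r) = fun y => expGauge (poleP r) A y * gluedK hA1 r y
        from rfl, hid, expConn_apply, val_expGaugeUnit_inv_eq_star hA1 hskew]
      rfl
    have hsm := norm_expConn_pole_le hA2 hskew hr hε0 hF hc hz1 hz2
      (by rw [inner_poleP]; nlinarith [abs_le.1 hz0abs]) v
    -- the derivative of `k`
    have hdk : ‖fderiv ℝ (gluedK hA1 r) z v‖ ≤ kDerivConst N Cχ * (ε / r) * ‖v‖ := by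
      by_cases hnorth : r / 8 < ⟪z, 𝕓 0⟫
      · have hO : IsOpen {y : 𝔼 | r / 8 < ⟪y, 𝕓 0⟫} := isOpen_lt continuous_const (continuous_id.inner continuous_const)
        have hev : gluedK hA1 r =ᶠ[𝓝 z] fun _ => (1 : 𝔤) := by
          filter_upwards [hO.mem_nhds hnorth] with y hy
          exact gluedK_eq_one_of hA1 hr (le_of_lt hy)
        rw [hev.fderiv_eq, fderiv_fun_const]
        simp only [Pi.zero_apply, zero_apply, norm_zero]
        positivity
      · exact norm_fderiv_gluedK_band_le hA1 hA2 hskew hr hε0 hε1 hF hCχ0 hCχ (by rw [hz]; linarith)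
          (by rw [hz]; linarith) (by linarith) (by linarith [not_lt.1 hnorth]) v
    rw [hB]
    calc ‖star (gluedK hA1 r z) * expConn hA1 (poleP r) z v * gluedK hA1 r z +
          star (gluedK hA1 r z) * fderiv ℝ (gluedK hA1 r) z v‖
        ≤ ‖star (gluedK hA1 r z) * expConn hA1 (poleP r) z v * gluedK hA1 r z‖ +
            ‖star (gluedK hA1 r z) * fderiv ℝ (gluedK hA1 r) z v‖ := norm_add_le _ _
      _ = ‖expConn hA1 (poleP r) z v‖ + ‖fderiv ℝ (gluedK hA1 r) z v‖ := by
          rw [norm_mul_unitary hku, norm_unitary_mul (Unitary.star_mem hku),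
            norm_unitary_mul (Unitary.star_mem hku)]
      _ ≤ 6 / 5 * (ε / r) * ‖v‖ + kDerivConst N Cχ * (ε / r) * ‖v‖ := add_le_add hsm hdk
      _ = (6 / 5 + kDerivConst N Cχ) * (ε / r) * ‖v‖ := by ring

end Sphere

end Literature.MathematicalPhysics.QuantumLattice
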